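import Summits.QuantumFields.YangMills.Theorems.LuscherReductionTwistedTraceScalingSliceEquiv
import Summits.QuantumFields.YangMills.Theorems.LuscherReductionTwistedTraceScalingGaugeActionBased
import HarnessLib

/-!
# The linearised Faddeev–Popov form in BASED coordinates is uniformly coercive: `‖ξ‖∞ ≤ 2C_L‖P_Γ D_u(ξ − ξ̄)‖` for `ξ(0) = 0`
# (lane A of S-BASE, crux `TwistedTraceScaling` stmt-QuantumFields-20203, C4 INNER; design note `pub/ym-fleet/ym-luscher-20007-p1/COARSE-DESIGN.md` §23.8 (N2))

In based gauge coordinates (`…GaugeAverageBased`, `…GaugeActionBased`) the exponent of the Faddeev–Popov weight at a slice point is, to leading order,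
`−‖P_Γ D_u(ξ − ξ̄)‖²/δ_g²` with `ξ(0) = 0`.  THIS FILE: the quadratic form is uniformly positive definite on based fields for slow variables near `1`:
* `norm_le_two_mul_norm_sub_siteMean`: `‖ξ‖∞ ≤ 2‖ξ − ξ̄‖∞` when `ξ(0) = 0` (`ξ̄ = −(ξ − ξ̄)(0)`);
* ★★ `norm_le_sliceConst_based`: `‖ξ‖∞ ≤ 2C_L·‖P_Γ(covGradL u (ξ − ξ̄))‖` for `ξ(0) = 0` and `|u⃗_k|∞ ≤ τ_L` (`…SliceEquiv`'s constants);
* ★ `basedForm_pos`: the form vanishes only at `ξ = 0` on based fields.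
So the based Gaussian `∫ exp(−‖P_Γ D_u(ξ−ξ̄)‖²/δ_g²) dξ` over `(ℝ³)^{|sites|−1}` converges with tails `exp(−c‖ξ‖²/δ_g²)`, `c = (2C_L)^{-2}` — the coercivity input of (N2).
HONEST FRAMING: finite-dimensional linear algebra for a stub of a child of the CONDITIONAL reduction route R2b1; no spectral claim; C4 OPEN; not a gap, not Clay.
-/

set_option autoImplicit false

noncomputable section

open Real
open scoped BigOperators
open Literature.MathematicalPhysics.QuantumFieldTheory
open Literature.MathematicalPhysics.QuantumLattice

namespace Summit.QuantumFields.YangMills.Theorems.FemtoTransferGap.TwoLattice.ConstTube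

open Summit.QuantumFields.YangMills.Theorems.FemtoTransferGap
open Summit.QuantumFields.YangMills.Theorems.FemtoTransferGap.TwoLattice.Stiff (LinkSpace)

variable (L : ℕ) [NeZero L]

/-- The re-centred field is mean-zero. [folklore] -/
theorem sub_siteMean_mem_meanZero (ξ : Site 3 L → Fin 3 → ℝ) : (fun x => ξ x - siteMean L ξ) ∈ meanZero L := sum_sub_siteMean L ξ

/-- For a based field, `‖ξ‖∞ ≤ 2‖ξ − ξ̄‖∞`. [folklore] -/
theorem norm_le_two_mul_norm_sub_siteMean {ξ : Site 3 L → Fin 3 → ℝ} (h0 : ξ 0 = 0) : ‖ξ‖ ≤ 2 * ‖fun x => ξ x - siteMean L ξ‖ := by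
  set η : Site 3 L → Fin 3 → ℝ := fun x => ξ x - siteMean L ξ with hη
  have hmean : siteMean L ξ = -η 0 := by simp [hη, h0]
  have hm : ‖siteMean L ξ‖ ≤ ‖η‖ := by rw [hmean, norm_neg]; exact norm_le_pi_norm η 0
  refine (pi_norm_le_iff_of_nonneg (by positivity)).mpr fun x => ?_
  have hx : ξ x = η x + siteMean L ξ := by simp [hη]
  rw [hx]
  calc ‖η x + siteMean L ξ‖ ≤ ‖η x‖ + ‖siteMean L ξ‖ := norm_add_le _ _
    _ ≤ ‖η‖ + ‖η‖ := add_le_add (norm_le_pi_norm η x) hm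
    _ = 2 * ‖η‖ := by ring

/-- ★★ **UNIFORM COERCIVITY OF THE BASED FORM**: `‖ξ‖∞ ≤ 2C_L·‖P_Γ(D_u(ξ − ξ̄))‖` for `ξ(0) = 0`, `|u⃗_k|∞ ≤ τ_L`. [folklore] -/
theorem norm_le_sliceConst_based {u : GaugeConfig 3 1 SU2} (hu : ∀ (k : Fin 3) (c : Fin 3), |vecPart (u (0, k)) c| ≤ sliceRadius L)
    {ξ : Site 3 L → Fin 3 → ℝ} (h0 : ξ 0 = 0) :
    ‖ξ‖ ≤ 2 * sliceConst L * ‖(gaugeModes L).starProjection (covGradL L u (fun x => ξ x - siteMean L ξ))‖ := by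
  have h1 := norm_le_two_mul_norm_sub_siteMean L h0
  have h2 := norm_le_sliceConst_mul L hu ⟨fun x => ξ x - siteMean L ξ, sub_siteMean_mem_meanZero L ξ⟩
  rw [coe_sliceMap] at h2
  calc ‖ξ‖ ≤ 2 * ‖fun x => ξ x - siteMean L ξ‖ := h1
    _ ≤ 2 * (sliceConst L * ‖(gaugeModes L).starProjection (covGradL L u (fun x => ξ x - siteMean L ξ))‖) := by
        exact mul_le_mul_of_nonneg_left h2 (by norm_num)
    _ = _ := by ring

/-- ★ The based form is positive definite: it vanishes only at `ξ = 0`. [folklore] -/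
theorem basedForm_pos {u : GaugeConfig 3 1 SU2} (hu : ∀ (k : Fin 3) (c : Fin 3), |vecPart (u (0, k)) c| ≤ sliceRadius L)
    {ξ : Site 3 L → Fin 3 → ℝ} (h0 : ξ 0 = 0) (hξ : ξ ≠ 0) :
    0 < ‖(gaugeModes L).starProjection (covGradL L u (fun x => ξ x - siteMean L ξ))‖ := by
  have h := norm_le_sliceConst_based L hu h0
  have hC := sliceConst_pos L
  have hξn : 0 < ‖ξ‖ := norm_pos_iff.mpr hξ
  by_contra hneg
  have h0' : ‖(gaugeModes L).starProjection (covGradL L u (fun x => ξ x - siteMean L ξ))‖ = 0 := le_antisymm (not_lt.mp hneg) (norm_nonneg _)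
  rw [h0', mul_zero] at h
  linarith

/-- ★ Quadratic lower bound: `‖P_Γ D_u(ξ − ξ̄)‖² ≥ ‖ξ‖∞²/(2C_L)²` on based fields. [folklore] -/
theorem basedForm_sq_ge {u : GaugeConfig 3 1 SU2} (hu : ∀ (k : Fin 3) (c : Fin 3), |vecPart (u (0, k)) c| ≤ sliceRadius L)
    {ξ : Site 3 L → Fin 3 → ℝ} (h0 : ξ 0 = 0) :
    ‖ξ‖ ^ 2 / (2 * sliceConst L) ^ 2 ≤ ‖(gaugeModes L).starProjection (covGradL L u (fun x => ξ x - siteMean L ξ))‖ ^ 2 := by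
  have h := norm_le_sliceConst_based L hu h0
  have hC := sliceConst_pos L
  rw [div_le_iff₀ (by positivity)]
  calc ‖ξ‖ ^ 2 ≤ (2 * sliceConst L * ‖(gaugeModes L).starProjection (covGradL L u (fun x => ξ x - siteMean L ξ))‖) ^ 2 :=
        pow_le_pow_left₀ (norm_nonneg _) h 2
    _ = _ := by ring

end Summit.QuantumFields.YangMills.Theorems.FemtoTransferGap.TwoLattice.ConstTube

end
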